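import Summits.AtomisticToContinuum.FouriersLaw.Theorems.VanishingNoiseTransferNoiseLocalityStubResponseDensityNoisyDyson2
import Summits.AtomisticToContinuum.FouriersLaw.Theorems.OddSectorIrreversibilityResponseDensityResponseIdentity
import Literature.MathematicalPhysics.KineticTheory.VelocityFlipNoise

/-!
# Flip-noisy response density, step 11 (auxiliary): Gibbs-measure integrability and symmetry facts
(helpers for stub `stub_responseDensityNoisy`)

Helper file `--supports stmt-AtomisticToContinuum-11975` (crux `NoiseLocality`, route
`VanishingNoiseTransfer`, line `relative-flip-energy-transfer`, stub 1b `stub_responseDensityNoisy`),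
namespace `…NoiseLocality.StubResponseDensityNoisy.Dyson`. Elementary facts about the Gibbs measure
`π_T` of the pinned chain used by the later steps:

* `integrable_gibbs_of_abs_le` — continuous `|f| ≤ C e^{2ϑH}` is `π_T`-integrable (`2ϑ < 1/(2T)`);
* `integral_gibbs_eq` — `∫ f dπ_T = Z⁻¹ ∫ e^{-H/T} f dx`; `integral_gibbs_oddMoment` — `π_T(p_0² - p_{N-1}²) = 0`;
  `integral_gibbs_flipAverage` — `π_T(Q f) = π_T(f)`;
* `integrable_gibbs_oddMoment_mul` — `(p_0² - p_{N-1}²) f ∈ L¹(π_T)` with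
  `|π_T((p_0² - p_{N-1}²) f)| ≤ C · π_T((1 + p_0² + p_{N-1}²) e^{ϑH})` for continuous `|f| ≤ C e^{ϑH}`.

No definitions.
-/

noncomputable section

open MeasureTheory ProbabilityTheory Filter Topology Set
open scoped NNReal ENNReal

namespace Summit.AtomisticToContinuum.FouriersLaw.Theorems.NoiseLocality.StubResponseDensityNoisy.Dyson

open Literature.MathematicalPhysics.KineticTheory.HeatConduction
open Literature.Probability.Process Literature.MathematicalPhysics.KineticTheory OscillatorChain

section GibbsAbs

variable {N : ℕ} {ω₂ lam β γ : ℝ} (hω : 0 < ω₂) (hl : 0 < lam) (hβ : 0 < β)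
  {T : ℝ} (hT : 0 < T) {ϑ : ℝ} (h2ϑT : 2 * ϑ < 1 / (2 * T))
include hω hl hβ hT h2ϑT

/-- Weighted continuous products are `π_T`-integrable: `|f| ≤ C e^{2ϑH}` with `f` continuous gives
`f ∈ L¹(π_T)` (`2ϑ < 1/T`). -/
theorem integrable_gibbs_of_abs_le {f : PhaseSpace N → ℝ} (hf : Continuous f) {C : ℝ}
    (hfb : ∀ y, |f y| ≤ C * Real.exp (2 * ϑ * (pinnedChain ω₂ lam β γ).hamiltonian N y)) :
    Integrable f ((pinnedChain ω₂ lam β γ).gibbsMeasure N T) := by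
  have h2θ : -1 / T + 2 * ϑ < 0 := by
    have h1 : 2 * ϑ < 1 / T := h2ϑT.trans (by rw [one_div_lt_one_div (by positivity) hT]; linarith)
    have : -1 / T + 2 * ϑ = 2 * ϑ - 1 / T := by ring
    rw [this]; linarith
  refine (pinnedChain ω₂ lam β γ).integrable_gibbsMeasure ?_
  have h1 := integrable_exp_mul_hamiltonian hω hl.le hβ.le γ h2θ (N := N)
  refine (h1.const_mul C).mono' (hf.mul ((pinnedChain ω₂ lam β γ).continuous_gibbsDensity
    (pinnedChain_contDiff_U ω₂ lam β γ (n := 0)).continuous (pinnedChain_contDiff_V ω₂ lam β γ (n := 0)).continuous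
    N T)).aestronglyMeasurable (Eventually.of_forall fun y => ?_)
  rw [Real.norm_eq_abs, abs_mul, OscillatorChain.gibbsDensity, abs_of_pos (Real.exp_pos _),
    show (-1 / T + 2 * ϑ) * (pinnedChain ω₂ lam β γ).hamiltonian N y =
      2 * ϑ * (pinnedChain ω₂ lam β γ).hamiltonian N y + -(pinnedChain ω₂ lam β γ).hamiltonian N y / T by ring,
    Real.exp_add]
  calc |f y| * Real.exp (-(pinnedChain ω₂ lam β γ).hamiltonian N y / T)
      ≤ C * Real.exp (2 * ϑ * (pinnedChain ω₂ lam β γ).hamiltonian N y) *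
        Real.exp (-(pinnedChain ω₂ lam β γ).hamiltonian N y / T) :=
        mul_le_mul_of_nonneg_right (hfb y) (Real.exp_pos _).le
    _ = _ := by ring

end GibbsAbs

/-! ### Gibbs-measure identities -/

section Gibbs

variable {N : ℕ} {ω₂ lam β γ : ℝ} (hω : 0 < ω₂) (hl : 0 < lam) (hβ : 0 < β) (hγ : 0 < γ) (hN : 0 < N)
  {T : ℝ} (hT : 0 < T)
include hω hl hβ hγ hN hT

omit hω hl hβ hγ hN hT in
/-- Lebesgue-to-Gibbs conversion: `∫ f dπ_T = Z⁻¹ ∫ e^{-H/T} f dx` with `Z = ∫ e^{-H/T} dx > 0`. -/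
theorem integral_gibbs_eq (f : PhaseSpace N → ℝ) :
    ∫ x, f x ∂((pinnedChain ω₂ lam β γ).gibbsMeasure N T) =
      (∫ x, (pinnedChain ω₂ lam β γ).gibbsDensity N T x)⁻¹ *
        ∫ x, Real.exp (-1 / T * (pinnedChain ω₂ lam β γ).hamiltonian N x) * f x := by
  rw [(pinnedChain ω₂ lam β γ).integral_gibbsMeasure]
  congr 1
  refine integral_congr_ae (Eventually.of_forall fun x => ?_)
  simp only [OscillatorChain.gibbsDensity]
  rw [show -(pinnedChain ω₂ lam β γ).hamiltonian N x / T = -1 / T * (pinnedChain ω₂ lam β γ).hamiltonian N x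
    by ring]
  ring

/-- **The odd Gibbs moment vanishes**: `π_T(p_0² - p_{N-1}²) = 0`. -/
theorem integral_gibbs_oddMoment :
    ∫ x : PhaseSpace N, (x.2 ⟨0, hN⟩ ^ 2 - x.2 ⟨N - 1, by omega⟩ ^ 2)
      ∂((pinnedChain ω₂ lam β γ).gibbsMeasure N T) = 0 := by
  rw [integral_gibbs_eq]
  have hϑ' : 1 / (4 * T) < 1 / max (T + T / 2) (T - T / 2) := by
    rw [show max (T + T / 2) (T - T / 2) = T + T / 2 from max_eq_left (by linarith),
      one_div_lt_one_div (by positivity) (by positivity)]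
    linarith
  rw [integral_gibbsWeight_oddMoment_eq_zero hω hl.le hβ.le hγ hN hT (δ := T) (by linarith) (by linarith)
    (by positivity : (0 : ℝ) < 1 / (4 * T)) hϑ' hT.ne', mul_zero]

omit hω hl hβ hγ hT in
/-- **`π_T` is flip invariant on observables**: `π_T(Q f) = π_T(f)` for `f ∘ momentumFlip i ∈ L¹(π_T)`. -/
theorem integral_gibbs_flipAverage {f : PhaseSpace N → ℝ}
    (hint : ∀ i : Fin N, Integrable (fun x => f (momentumFlip i x)) ((pinnedChain ω₂ lam β γ).gibbsMeasure N T)) :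
    ∫ x, (N : ℝ)⁻¹ * ∑ i : Fin N, f (momentumFlip i x) ∂((pinnedChain ω₂ lam β γ).gibbsMeasure N T) =
      ∫ x, f x ∂((pinnedChain ω₂ lam β γ).gibbsMeasure N T) := by
  have hNR : (N : ℝ) ≠ 0 := Nat.cast_ne_zero.2 hN.ne'
  rw [integral_const_mul, integral_finsetSum _ fun i _ => hint i]
  simp_rw [integral_comp_momentumFlip ((pinnedChain ω₂ lam β γ).measurePreserving_momentumFlip_gibbsMeasure N T _)]
  rw [Finset.sum_const, Finset.card_univ, Fintype.card_fin, nsmul_eq_mul, ← mul_assoc, inv_mul_cancel₀ hNR, one_mul]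

end Gibbs

section OddMoment

variable {N : ℕ} {ω₂ lam β γ : ℝ} (hω : 0 < ω₂) (hl : 0 < lam) (hβ : 0 < β) (hγ : 0 < γ) (hN : 0 < N)
  {T : ℝ} (hT : 0 < T) {ϑ : ℝ} (h2ϑT : 2 * ϑ < 1 / (2 * T))
include hω hl hβ hγ hN hT h2ϑT

omit hγ in
/-- The odd moment against weighted observables: `(p_0² - p_{N-1}²) f ∈ L¹(π_T)` and
`|π_T((p_0² - p_{N-1}²) f)| ≤ C · I_g` for continuous `|f| ≤ C e^{ϑH}`, where
`I_g = π_T((1 + p_0² + p_{N-1}²) e^{ϑH}) < ∞`. -/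
theorem integrable_gibbs_oddMoment_mul :
    Integrable (fun x : PhaseSpace N => (1 + x.2 ⟨0, hN⟩ ^ 2 + x.2 ⟨N - 1, by omega⟩ ^ 2) *
        Real.exp (ϑ * (pinnedChain ω₂ lam β γ).hamiltonian N x)) ((pinnedChain ω₂ lam β γ).gibbsMeasure N T) ∧
    ∀ {f : PhaseSpace N → ℝ}, Continuous f → ∀ {C : ℝ}, 0 ≤ C →
      (∀ y, |f y| ≤ C * Real.exp (ϑ * (pinnedChain ω₂ lam β γ).hamiltonian N y)) →
      Integrable (fun x : PhaseSpace N => (x.2 ⟨0, hN⟩ ^ 2 - x.2 ⟨N - 1, by omega⟩ ^ 2) * f x)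
          ((pinnedChain ω₂ lam β γ).gibbsMeasure N T) ∧
        |∫ x, (x.2 ⟨0, hN⟩ ^ 2 - x.2 ⟨N - 1, by omega⟩ ^ 2) * f x ∂((pinnedChain ω₂ lam β γ).gibbsMeasure N T)| ≤
          C * ∫ x, (1 + x.2 ⟨0, hN⟩ ^ 2 + x.2 ⟨N - 1, by omega⟩ ^ 2) *
            Real.exp (ϑ * (pinnedChain ω₂ lam β γ).hamiltonian N x) ∂((pinnedChain ω₂ lam β γ).gibbsMeasure N T) := by
  set Pc := pinnedChain ω₂ lam β γ with hPc
  have hHc : Continuous (Pc.hamiltonian N) := pinnedChain_continuous_hamiltonian ω₂ lam β γ N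
  have hθϑ : -1 / T + ϑ < 0 := by
    have h1 : ϑ < 1 / T := by
      have : 2 * ϑ < 1 / (2 * T) := h2ϑT
      rw [lt_div_iff₀ (by positivity)] at this; rw [lt_div_iff₀ hT]; nlinarith
    have : -1 / T + ϑ = ϑ - 1 / T := by ring
    rw [this]; linarith
  have hmc : Continuous fun x : PhaseSpace N => (1 + x.2 ⟨0, hN⟩ ^ 2 + x.2 ⟨N - 1, by omega⟩ ^ 2) := by fun_prop
  have hgc : Continuous fun x : PhaseSpace N => (x.2 ⟨0, hN⟩ ^ 2 - x.2 ⟨N - 1, by omega⟩ ^ 2) := by fun_prop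
  have hec : Continuous fun x => Real.exp (ϑ * Pc.hamiltonian N x) := Real.continuous_exp.comp (continuous_const.mul hHc)
  -- integrability of `(1 + p² + p²) e^{ϑH}` against `π_T`
  have hI : Integrable (fun x : PhaseSpace N => (1 + x.2 ⟨0, hN⟩ ^ 2 + x.2 ⟨N - 1, by omega⟩ ^ 2) *
      Real.exp (ϑ * Pc.hamiltonian N x)) (Pc.gibbsMeasure N T) := by
    refine Pc.integrable_gibbsMeasure ?_
    refine (integrable_momentSq_mul_exp_mul_hamiltonian hω hl.le hβ.le γ hN hθϑ (N := N)).congr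
      (Eventually.of_forall fun x => ?_)
    simp only [OscillatorChain.gibbsDensity]
    rw [show (-1 / T + ϑ) * Pc.hamiltonian N x = ϑ * Pc.hamiltonian N x + -Pc.hamiltonian N x / T by ring,
      Real.exp_add]
    ring
  refine ⟨hI, fun {f} hf {C} hC hfb => ?_⟩
  have hdom : ∀ x : PhaseSpace N, |(x.2 ⟨0, hN⟩ ^ 2 - x.2 ⟨N - 1, by omega⟩ ^ 2) * f x| ≤
      C * ((1 + x.2 ⟨0, hN⟩ ^ 2 + x.2 ⟨N - 1, by omega⟩ ^ 2) * Real.exp (ϑ * Pc.hamiltonian N x)) := by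
    intro x
    have hp : |x.2 ⟨0, hN⟩ ^ 2 - x.2 ⟨N - 1, by omega⟩ ^ 2| ≤ 1 + x.2 ⟨0, hN⟩ ^ 2 + x.2 ⟨N - 1, by omega⟩ ^ 2 := by
      rw [abs_le]; constructor <;> nlinarith [sq_nonneg (x.2 ⟨0, hN⟩), sq_nonneg (x.2 ⟨N - 1, by omega⟩)]
    rw [abs_mul]
    calc |x.2 ⟨0, hN⟩ ^ 2 - x.2 ⟨N - 1, by omega⟩ ^ 2| * |f x|
        ≤ (1 + x.2 ⟨0, hN⟩ ^ 2 + x.2 ⟨N - 1, by omega⟩ ^ 2) * (C * Real.exp (ϑ * Pc.hamiltonian N x)) :=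
          mul_le_mul hp (hfb x) (abs_nonneg _) (by positivity)
      _ = _ := by ring
  have hgi : Integrable (fun x : PhaseSpace N => (x.2 ⟨0, hN⟩ ^ 2 - x.2 ⟨N - 1, by omega⟩ ^ 2) * f x)
      (Pc.gibbsMeasure N T) :=
    (hI.const_mul C).mono' (hgc.mul hf).aestronglyMeasurable
      (Eventually.of_forall fun x => by rw [Real.norm_eq_abs]; exact hdom x)
  refine ⟨hgi, ?_⟩
  calc |∫ x, (x.2 ⟨0, hN⟩ ^ 2 - x.2 ⟨N - 1, by omega⟩ ^ 2) * f x ∂(Pc.gibbsMeasure N T)|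
      ≤ ∫ x, |(x.2 ⟨0, hN⟩ ^ 2 - x.2 ⟨N - 1, by omega⟩ ^ 2) * f x| ∂(Pc.gibbsMeasure N T) := abs_integral_le_integral_abs
    _ ≤ ∫ x, C * ((1 + x.2 ⟨0, hN⟩ ^ 2 + x.2 ⟨N - 1, by omega⟩ ^ 2) * Real.exp (ϑ * Pc.hamiltonian N x))
        ∂(Pc.gibbsMeasure N T) := integral_mono hgi.abs (hI.const_mul C) hdom
    _ = _ := integral_const_mul _ _

end OddMoment

/-- Registered helper sub-goal `helper_responseDensityNoisyDysonGibbsOddMoment` of stmt-AtomisticToContinuum-11975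
(fully quantified, notation-free one-line form of the main theorem of this file). -/
theorem helper_responseDensityNoisyDysonGibbsOddMoment : ∀ (ω₂ lam β γ : ℝ) (hω : 0 < ω₂) (hl : 0 < lam) (hβ : 0 < β) (N : ℕ) (hN : 0 < N) (T : ℝ) (hT : 0 < T) (ϑ : ℝ) (h2ϑT : 2 * ϑ < 1 / (2 * T)), MeasureTheory.Integrable (fun x : Literature.MathematicalPhysics.KineticTheory.HeatConduction.PhaseSpace N => (1 + x.2 ⟨0, hN⟩ ^ 2 + x.2 ⟨N - 1, by omega⟩ ^ 2) * Real.exp (ϑ * (Literature.MathematicalPhysics.KineticTheory.HeatConduction.pinnedChain ω₂ lam β γ).hamiltonian N x)) ((Literature.MathematicalPhysics.KineticTheory.HeatConduction.pinnedChain ω₂ lam β γ).gibbsMeasure N T) ∧ ∀ {f : Literature.MathematicalPhysics.KineticTheory.HeatConduction.PhaseSpace N → ℝ}, Continuous f → ∀ {C : ℝ}, 0 ≤ C → (∀ y, |f y| ≤ C * Real.exp (ϑ * (Literature.MathematicalPhysics.KineticTheory.HeatConduction.pinnedChain ω₂ lam β γ).hamiltonian N y)) → MeasureTheory.Integrable (fun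 x : Literature.MathematicalPhysics.KineticTheory.HeatConduction.PhaseSpace N => (x.2 ⟨0, hN⟩ ^ 2 - x.2 ⟨N - 1, by omega⟩ ^ 2) * f x) ((Literature.MathematicalPhysics.KineticTheory.HeatConduction.pinnedChain ω₂ lam β γ).gibbsMeasure N T) ∧ |∫ x, (x.2 ⟨0, hN⟩ ^ 2 - x.2 ⟨N - 1, by omega⟩ ^ 2) * f x ∂((Literature.MathematicalPhysics.KineticTheory.HeatConduction.pinnedChain ω₂ lam β γ).gibbsMeasure N T)| ≤ C * ∫ x, (1 + x.2 ⟨0, hN⟩ ^ 2 + x.2 ⟨N - 1, by omega⟩ ^ 2) * Real.exp (ϑ * (Literature.MathematicalPhysics.KineticTheory.HeatConduction.pinnedChain ω₂ lam β γ).hamiltonian N x) ∂((Literature.MathematicalPhysics.KineticTheory.HeatConduction.pinnedChain ω₂ lam β γ).gibbsMeasure N T) :=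
  fun _ _ _ γ hω hl hβ _ hN _ hT _ h2ϑT => integrable_gibbs_oddMoment_mul hω hl hβ hN hT h2ϑT (γ := γ)

end Summit.AtomisticToContinuum.FouriersLaw.Theorems.NoiseLocality.StubResponseDensityNoisy.Dyson

end
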